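import Literature.AlgebraicGeometry.Resolution.QuadraticTransformsTransport
import Literature.AlgebraicGeometry.Resolution.QuadraticTransformsRegular
import Literature.AlgebraicGeometry.Resolution.QuadraticSequenceDimOneExistence
import Literature.AlgebraicGeometry.Resolution.TranscendentallyImmediate
import Literature.AlgebraicGeometry.Resolution.IntegralClosureEssFiniteType

/-!
# Base dimension two of `LuAlphaPTorsor`: the local ring of the base inside `Frac A₀`

Helper file for the stub `stub_dimTwoMonomialization` of the line `pfaff-line-log-final-forms`
(crux `Valuative.LuAlphaPTorsor`, item `stmt-ResolutionOfSingularities-0641`). In that stub the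
base `A₀ ⊆ O` is a finitely generated `k`-subalgebra of `K`, regular of dimension two at the
centre of the valuation ring `O`, but `K` is NOT the fraction field of `A₀`; the dimension-two
birational geometry (quadratic transforms along the valuation, Abhyankar's union lemma) has to be
run inside the subfield `K₀ = Frac A₀`, realised as an abstract field `K'` with an embedding
`ι : K' →+* K`. This file supplies the plumbing, all [folklore]:

* transport of `locAtCentre` (`LocalBlowup.lean`) along `ι`: `comap_locAtCentre` (the pull-back
  `Subring.comap ι` commutes with localisation at the centre, for the pulled-back valuation ring
  `O.comap ι`), `locAtCentre_le_range`, the sandwich `locAtCentre_eq_of_le_of_le`, and the shape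
  `R n = (B[t])_{𝔪 ∩ B[t]}` of the members of a tower of quadratic transforms starting at
  `B_{𝔪 ∩ B}` (`exists_eq_locAtCentre_closure_of_sequence`);
* `isQuadraticTransformAlong_quadraticSeq_of_isRegularLocalRing` — the sequence `quadraticSeq`
  (`QuadraticSequenceDimOneExistence.lean`) of a regular local subring which is not a field,
  along a dominating valuation ring, IS an infinite sequence of quadratic transforms (every
  member is regular, hence Noetherian, dominated, and not a field);
* `finite_integralClosure_quotient_of_ringEquiv`, `…_localization_atPrime` — the "Japanese in
  dimension one" hypothesis of `stub_curveMonomialization` (one-dimensional prime quotients have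
  finite normalisation) transfers along ring isomorphisms and holds for localisations of algebras
  of finite type over a field (domains essentially of finite type over a field have finite
  normalisation, `module_finite_integralClosure_of_essFiniteType`);
* `exists_ringEquiv_atPrime`, `base_locAtCentre_comap` — the pull-back to `K'` of the local ring
  of a model `B ⊆ O`, `B ≤ range ι`, at the centre is `Localization.AtPrime (𝔪_O ∩ B)`
  compatibly with the structure map; hence the local ring `R₀` of the pulled-back base at the
  centre of `O.comap ι` is a two-dimensional regular local ring OF `K'`, dominated, Japanese in
  dimension one — the hypotheses of `stub_curveMonomialization` and of
  `AbhyankarQuadraticUnion_holds`.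
-/

set_option linter.dupNamespace false

namespace Summit.ResolutionOfSingularities.ResolutionOfSingularities.Theorems.PfaffLine

open IsLocalRing Literature.AlgebraicGeometry.Resolution

/-! ## Transport along a field embedding -/

section transport

variable {K₀ L : Type} [Field K₀] [Field L]

/-- The valuation of the pulled-back valuation ring `O.comap ι` takes the value `1` at `z` iff
the valuation of `O` takes the value `1` at `ι z` (the tree's `valuation_comap_eq_one_iff` is the
case `ι = algebraMap`). [folklore] -/
theorem valuation_comap_eq_one_iff_of_ringHom (ι : K₀ →+* L) (O : ValuationSubring L) (z : K₀) :
    (O.comap ι).valuation z = 1 ↔ O.valuation (ι z) = 1 := by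
  by_cases hz : z = 0
  · subst hz
    simp
  · rw [valuation_eq_one_iff_mem_and_inv_mem _ hz,
      valuation_eq_one_iff_mem_and_inv_mem _ ((map_ne_zero ι).mpr hz),
      ValuationSubring.mem_comap, ValuationSubring.mem_comap, map_inv₀]

/-! ### `locAtCentre` and pull-back -/

/-- The range of a field homomorphism is closed under division. [folklore] -/
theorem div_mem_ringHom_range (ι : K₀ →+* L) {x y : L} (hx : x ∈ ι.range) (hy : y ∈ ι.range) :
    x / y ∈ ι.range := by
  obtain ⟨a, rfl⟩ := hx
  obtain ⟨b, rfl⟩ := hy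
  exact ⟨a / b, map_div₀ ι a b⟩

/-- `B ≤ range ι ⇒ B_{𝔪_O ∩ B} ≤ range ι`. [folklore] -/
theorem locAtCentre_le_range (ι : K₀ →+* L) (O : ValuationSubring L) {B : Subring L}
    (hB : B ≤ ι.range) : locAtCentre B O ≤ ι.range := by
  rintro _ ⟨y, hy, z, hz, -, rfl⟩
  exact div_mem_ringHom_range ι (hB hy) (hB hz)

/-- **Pull-back commutes with localisation at the centre**: for `B ≤ range ι`,
`(B_{𝔪_O ∩ B}).comap ι = (B.comap ι)_{𝔪_{O'} ∩ B.comap ι}` with `O' = O.comap ι`. [folklore] -/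
theorem comap_locAtCentre :
    ∀ {K₀ L : Type} [Field K₀] [Field L] (ι : K₀ →+* L) (O : ValuationSubring L) {B : Subring L}, B ≤ ι.range → (Literature.AlgebraicGeometry.Resolution.locAtCentre B O).comap ι = Literature.AlgebraicGeometry.Resolution.locAtCentre (B.comap ι) (O.comap ι) := by
  intro K₀ L _ _ ι O B hB
  ext x
  rw [Subring.mem_comap, mem_locAtCentre_iff, mem_locAtCentre_iff]
  constructor
  · rintro ⟨y, hy, z, hz, hv, hx⟩
    obtain ⟨y₀, rfl⟩ := hB hy
    obtain ⟨z₀, rfl⟩ := hB hz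
    refine ⟨y₀, hy, z₀, hz, (valuation_comap_eq_one_iff_of_ringHom ι O z₀).mpr hv, ι.injective ?_⟩
    rw [hx, map_div₀]
  · rintro ⟨y₀, hy, z₀, hz, hv, rfl⟩
    refine ⟨ι y₀, hy, ι z₀, hz, (valuation_comap_eq_one_iff_of_ringHom ι O z₀).mp hv, map_div₀ ι y₀ z₀⟩

/-- The pull-back of a subring of `O` lies in `O.comap ι`. [folklore] -/
theorem comap_le_comap_valuationSubring (ι : K₀ →+* L) {O : ValuationSubring L} {B : Subring L}
    (hB : B ≤ O.toSubring) : B.comap ι ≤ (O.comap ι).toSubring :=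
  fun _ hx => hB hx

/-! ### Sandwiches of `locAtCentre` -/

/-- **Sandwich**: if `B ≤ B' ≤ B_{𝔪_O ∩ B}` then `B'_{𝔪_O ∩ B'} = B_{𝔪_O ∩ B}`. [folklore] -/
theorem locAtCentre_eq_of_le_of_le (O : ValuationSubring L) {B B' : Subring L} (h₁ : B ≤ B')
    (h₂ : B' ≤ locAtCentre B O) : locAtCentre B' O = locAtCentre B O :=
  le_antisymm ((locAtCentre_mono O h₂).trans (locAtCentre_locAtCentre B O).le)
    (locAtCentre_mono O h₁)

/-- A tower of quadratic transforms along `O` starting at `B_{𝔪_O ∩ B}` (`B ≤ O`) consists of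
local blowing ups of `B`: every member is `(B[t])_{𝔪_O ∩ B[t]}` for a finite `t ⊆ O`.
[folklore] -/
theorem exists_eq_locAtCentre_closure_of_sequence {O : ValuationSubring L} {B : Subring L}
    (hB : B ≤ O.toSubring) {R : ℕ → Subring L} (h0 : R 0 = locAtCentre B O)
    (hstep : ∀ i, IsQuadraticTransformAlong O (R i) (R (i + 1))) (n : ℕ) :
    ∃ t : Finset L, (↑t : Set L) ⊆ O ∧ R n = locAtCentre (Subring.closure ((B : Set L) ∪ ↑t)) O := by
  have key : IsLocalBlowup O B (R n) := by
    induction n with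
    | zero => rw [h0]; exact IsLocalBlowup.locAtCentre_self hB
    | succ n ih => exact ih.trans (hstep n).isLocalBlowup
  obtain ⟨-, t, ht, he⟩ := key
  exact ⟨t, ht, he⟩

/-! ### Fractions -/

/-- If every element of `range ι` is a fraction of elements of `B ≤ range ι`, then every
element of `K₀` is a fraction of elements of `B.comap ι`. [folklore] -/
theorem exists_div_eq_of_comap (ι : K₀ →+* L) {B : Subring L}
    (hfrac : ∀ z : K₀, ∃ a ∈ B, ∃ b ∈ B, ι z = a / b) (hB : B ≤ ι.range) (z : K₀) :
    ∃ a ∈ B.comap ι, ∃ b ∈ B.comap ι, b ≠ 0 ∧ z = a / b := by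
  obtain ⟨a, ha, b, hb, hz⟩ := hfrac z
  obtain ⟨a₀, rfl⟩ := hB ha
  obtain ⟨b₀, rfl⟩ := hB hb
  by_cases hb0 : b₀ = 0
  · refine ⟨0, (B.comap ι).zero_mem, 1, (B.comap ι).one_mem, one_ne_zero, ?_⟩
    apply ι.injective
    rw [hz, hb0, map_zero, div_zero, zero_div, map_zero]
  · refine ⟨a₀, ha, b₀, hb, hb0, ι.injective ?_⟩
    rw [hz, map_div₀]

end transport

/-! ## The quadratic sequence of a regular local ring -/

section sequence

variable {K : Type} [Field K]

/-- A ring of nonzero Krull dimension is not a field. [folklore] -/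
theorem not_isField_of_ringKrullDim_ne_zero {R : Type} [CommRing R] (h : ringKrullDim R ≠ 0) :
    ¬ IsField R :=
  fun hF => h (ringKrullDim_eq_zero_of_isField hF)

/-- **The quadratic sequence of a regular local ring along a dominating valuation ring is an
infinite sequence of quadratic transforms** (every member is regular, dominated by `O`, and not
a field, so the next transform exists). [folklore] -/
theorem isQuadraticTransformAlong_quadraticSeq_of_isRegularLocalRing {O : ValuationSubring K}
    {R₀ : Subring K} (hreg : IsRegularLocalRing R₀) (hR₀ : ¬ IsField R₀)
    (h0 : SubringDominates R₀ O.toSubring) (n : ℕ) :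
    IsQuadraticTransformAlong O (quadraticSeq O R₀ n) (quadraticSeq O R₀ (n + 1)) := by
  -- invariant: `R_n` is regular, contains `R₀`, and is dominated by `O`
  have inv : ∀ n, IsRegularLocalRing (quadraticSeq O R₀ n) ∧ R₀ ≤ quadraticSeq O R₀ n ∧
      SubringDominates (quadraticSeq O R₀ n) O.toSubring ∧
      IsQuadraticTransformAlong O (quadraticSeq O R₀ n) (quadraticSeq O R₀ (n + 1)) := by
    intro n
    induction n with
    | zero =>
      haveI : IsRegularLocalRing (quadraticSeq O R₀ 0) := hreg
      refine ⟨hreg, le_rfl, h0, ?_⟩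
      exact quadraticSeq_succ_of_exists (exists_isQuadraticTransformAlong h0.1
        (maximalIdeal_ne_bot_of_subringDominates (B := quadraticSeq O R₀ 0) hR₀ h0 le_rfl h0.1))
    | succ n ih =>
      obtain ⟨hregn, hle, -, hstepn⟩ := ih
      haveI : IsRegularLocalRing (quadraticSeq O R₀ (n + 1)) :=
        hstepn.isRegularLocalRing_of_isRegularLocalRing hregn
      haveI : IsLocalRing R₀ := hreg.toIsLocalRing
      have hle1 : R₀ ≤ quadraticSeq O R₀ (n + 1) := hle.trans hstepn.le
      have hdom1 : SubringDominates (quadraticSeq O R₀ (n + 1)) O.toSubring := hstepn.dominated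
      refine ⟨‹_›, hle1, hdom1, ?_⟩
      exact quadraticSeq_succ_of_exists (exists_isQuadraticTransformAlong hdom1.1
        (maximalIdeal_ne_bot_of_subringDominates hR₀ h0 hle1 hdom1.1))
  exact (inv n).2.2.2

/-- The dimension-two case: the quadratic sequence of a two-dimensional regular local subring
dominated by `O` is an infinite sequence of quadratic transforms along `O`. [folklore] -/
theorem isQuadraticTransformAlong_quadraticSeq_of_ringKrullDim_eq_two {O : ValuationSubring K}
    {R₀ : Subring K} (hreg : IsRegularLocalRing R₀) (hdim : ringKrullDim R₀ = 2)
    (h0 : SubringDominates R₀ O.toSubring) (n : ℕ) :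
    IsQuadraticTransformAlong O (quadraticSeq O R₀ n) (quadraticSeq O R₀ (n + 1)) :=
  isQuadraticTransformAlong_quadraticSeq_of_isRegularLocalRing hreg
    (not_isField_of_ringKrullDim_ne_zero (R := R₀) (by rw [hdim]; decide)) h0 n

end sequence

/-! ## Finite normalisation of one-dimensional prime quotients -/

section japanese

/-- **Transfer along a ring isomorphism** of the property "every prime quotient of dimension one
has finite normalisation in every fraction field". [folklore] -/
theorem finite_integralClosure_quotient_of_ringEquiv {R S : Type} [CommRing R] [CommRing S]
    (e : R ≃+* S)
    (hS : ∀ (𝔮 : Ideal S) (L : Type) [Field L] [Algebra (S ⧸ 𝔮) L] [IsFractionRing (S ⧸ 𝔮) L],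
      𝔮.IsPrime → ringKrullDim (S ⧸ 𝔮) = 1 →
        Module.Finite (S ⧸ 𝔮) (integralClosure (S ⧸ 𝔮) L)) :
    ∀ (𝔮 : Ideal R) (L : Type) [Field L] [Algebra (R ⧸ 𝔮) L] [IsFractionRing (R ⧸ 𝔮) L],
      𝔮.IsPrime → ringKrullDim (R ⧸ 𝔮) = 1 →
        Module.Finite (R ⧸ 𝔮) (integralClosure (R ⧸ 𝔮) L) := by
  intro 𝔮 L _ _ _ h𝔮 hdim
  haveI : (𝔮.map (e : R →+* S)).IsPrime := Ideal.map_isPrime_of_equiv e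
  -- the induced isomorphism of quotients, and `L` as a fraction field of `S ⧸ 𝔮.map e`
  let ē : R ⧸ 𝔮 ≃+* S ⧸ 𝔮.map (e : R →+* S) := Ideal.quotientEquiv 𝔮 _ e rfl
  letI : Algebra (S ⧸ 𝔮.map (e : R →+* S)) L :=
    ((algebraMap (R ⧸ 𝔮) L).comp ē.symm.toRingHom).toAlgebra
  have halg : (algebraMap (S ⧸ 𝔮.map (e : R →+* S)) L) =
      (algebraMap (R ⧸ 𝔮) L).comp ē.symm.toRingHom := rfl
  haveI : IsFractionRing (S ⧸ 𝔮.map (e : R →+* S)) L :=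
    (IsFractionRing.isFractionRing_iff_of_base_ringEquiv L ē).mp ‹_›
  have hdim' : ringKrullDim (S ⧸ 𝔮.map (e : R →+* S)) = 1 := by
    rw [← ringKrullDim_eq_of_ringEquiv ē]; exact hdim
  haveI hfin := hS (𝔮.map (e : R →+* S)) L inferInstance hdim'
  -- the two integral closures have the same underlying set
  have h1 : ∀ x : L, IsIntegral (S ⧸ 𝔮.map (e : R →+* S)) x → IsIntegral (R ⧸ 𝔮) x := by
    intro x hx
    have := hx.map_of_comp_eq (T := R ⧸ 𝔮) (U := L) ē.symm.toRingHom (RingHom.id L) (by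
      rw [halg, RingHom.id_comp])
    simpa using this
  have h2 : ∀ x : L, IsIntegral (R ⧸ 𝔮) x → IsIntegral (S ⧸ 𝔮.map (e : R →+* S)) x := by
    intro x hx
    have := hx.map_of_comp_eq (T := S ⧸ 𝔮.map (e : R →+* S)) (U := L) ē.toRingHom
      (RingHom.id L) (by
        rw [halg, RingHom.id_comp, RingHom.comp_assoc]
        ext y
        simp)
    simpa using this
  let e₂ : integralClosure (S ⧸ 𝔮.map (e : R →+* S)) L ≃+* integralClosure (R ⧸ 𝔮) L :=
    { toFun := fun x => ⟨x, h1 x x.2⟩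
      invFun := fun x => ⟨x, h2 x x.2⟩
      left_inv := fun _ => rfl
      right_inv := fun _ => rfl
      map_mul' := fun _ _ => rfl
      map_add' := fun _ _ => rfl }
  refine Module.Finite.of_equiv_equiv ē.symm e₂ ?_
  ext x
  rfl

/-- **Localisations of algebras of finite type over a field are "Japanese in dimension one"**:
for `A` of finite type over a field `k` and a prime `P` of `A`, every prime quotient of `A_P`
(of dimension one, a hypothesis not needed) has finite normalisation in every fraction field —
it is a domain essentially of finite type over `k`. [folklore] -/
theorem finite_integralClosure_quotient_localization_atPrime {k A : Type} [Field k] [CommRing A]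
    [Algebra k A] [Algebra.FiniteType k A] (P : Ideal A) [P.IsPrime] :
    ∀ (𝔮 : Ideal (Localization.AtPrime P)) (L : Type) [Field L]
      [Algebra (Localization.AtPrime P ⧸ 𝔮) L] [IsFractionRing (Localization.AtPrime P ⧸ 𝔮) L],
      𝔮.IsPrime → ringKrullDim (Localization.AtPrime P ⧸ 𝔮) = 1 →
        Module.Finite (Localization.AtPrime P ⧸ 𝔮)
          (integralClosure (Localization.AtPrime P ⧸ 𝔮) L) := by
  intro 𝔮 L _ _ _ h𝔮 _
  exact module_finite_integralClosure_of_essFiniteType k _ L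

end japanese

/-! ## The base ring inside the subfield -/

section base

variable {k K K' : Type} [Field k] [Field K] [Algebra k K] [Field K']

/-- **The local ring of a model at the centre, pulled back to a subfield, as an abstract
localisation.** For `B ≤ O` inside the range of `ι : K' →+* K`, the pull-back `Rᵢ` of
`B_{𝔪_O ∩ B}` to `K'` is isomorphic to `Localization.AtPrime (𝔪_O ∩ B)`, compatibly with the
structure map on the elements of `B`. [folklore] -/
theorem exists_ringEquiv_atPrime (ι : K' →+* K) (O : ValuationSubring K) (B : Subring K)
    (h₁ : B ≤ O.toSubring) (hB : B ≤ ι.range) {Rᵢ : Subring K'}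
    (hRᵢ : (locAtCentre B O).comap ι = Rᵢ) :
    ∃ e : Rᵢ ≃+* Localization.AtPrime (Ideal.comap (Subring.inclusion h₁) (maximalIdeal O)),
      ∀ (z : Rᵢ) (hz : ι z ∈ B), e z = algebraMap B _ ⟨ι z, hz⟩ := by
  subst hRᵢ
  let e₁ := comapEquivOfLeRange ι (locAtCentre B O) (locAtCentre_le_range ι O hB)
  let e₂ := (locAtCentreEquiv h₁).symm
  refine ⟨e₁.trans e₂.toRingEquiv, fun z hz => ?_⟩
  have h1 : e₁ z = algebraMap B (locAtCentre B O) ⟨ι z, hz⟩ :=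
    Subtype.ext (coe_comapEquivOfLeRange ι _ _ z)
  rw [RingEquiv.trans_apply, h1]
  exact e₂.commutes _

/-- **The base ring inside the subfield.** For a finitely generated `A₀ ⊆ O`, regular of
dimension two at the centre of `O`, contained in the range of a field embedding `ι : K' →+* K`
of which every element is a fraction of elements of `A₀`: the local ring
`R₀ = (A₀')_{𝔪_{O'} ∩ A₀'}` of the pulled-back model `A₀' = A₀.comap ι` at the centre of the
pulled-back valuation ring `O' = O.comap ι` is a two-dimensional regular local ring OF `K'`
dominated by `O'`, all of whose one-dimensional prime quotients have finite normalisation.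
[folklore] -/
theorem base_locAtCentre_comap (ι : K' →+* K) (O : ValuationSubring K) (A₀ : Subalgebra k K)
    (h₀ : A₀.toSubring ≤ O.toSubring) (hfg : A₀.FG)
    (hreg : IsRegularLocalRing
      (Localization.AtPrime (Ideal.comap (Subring.inclusion h₀) (maximalIdeal O))))
    (hdim : ringKrullDim
      (Localization.AtPrime (Ideal.comap (Subring.inclusion h₀) (maximalIdeal O))) = 2)
    (hA₀ : A₀.toSubring ≤ ι.range)
    (hfrac : ∀ z : K', ∃ a ∈ A₀.toSubring, ∃ c ∈ A₀.toSubring, ι z = a / c) :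
    IsRegularLocalRing (locAtCentre (A₀.toSubring.comap ι) (O.comap ι)) ∧
    ringKrullDim (locAtCentre (A₀.toSubring.comap ι) (O.comap ι)) = 2 ∧
    IsLocalRingOf (locAtCentre (A₀.toSubring.comap ι) (O.comap ι)) ∧
    SubringDominates (locAtCentre (A₀.toSubring.comap ι) (O.comap ι)) (O.comap ι).toSubring ∧
    ∀ (𝔮 : Ideal (locAtCentre (A₀.toSubring.comap ι) (O.comap ι))) (L : Type) [Field L]
      [Algebra (locAtCentre (A₀.toSubring.comap ι) (O.comap ι) ⧸ 𝔮) L]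
      [IsFractionRing (locAtCentre (A₀.toSubring.comap ι) (O.comap ι) ⧸ 𝔮) L],
      𝔮.IsPrime → ringKrullDim (locAtCentre (A₀.toSubring.comap ι) (O.comap ι) ⧸ 𝔮) = 1 →
        Module.Finite (locAtCentre (A₀.toSubring.comap ι) (O.comap ι) ⧸ 𝔮)
          (integralClosure (locAtCentre (A₀.toSubring.comap ι) (O.comap ι) ⧸ 𝔮) L) := by
  have heq : (locAtCentre A₀.toSubring O).comap ι = locAtCentre (A₀.toSubring.comap ι) (O.comap ι) :=
    comap_locAtCentre ι O hA₀
  have h₀' : A₀.toSubring.comap ι ≤ (O.comap ι).toSubring := comap_le_comap_valuationSubring ι h₀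
  obtain ⟨e, -⟩ := exists_ringEquiv_atPrime ι O A₀.toSubring h₀ hA₀ heq
  haveI := hreg
  refine ⟨IsRegularLocalRing.of_ringEquiv e.symm, (ringKrullDim_eq_of_ringEquiv e).trans hdim,
    ⟨isLocalRing_locAtCentre h₀', fun z => ?_⟩, subringDominates_locAtCentre h₀', ?_⟩
  · rw [← heq]
    refine exists_div_eq_of_comap ι (fun z => ?_) (locAtCentre_le_range ι O hA₀) z
    obtain ⟨a, ha, c, hc, hz⟩ := hfrac z
    exact ⟨a, le_locAtCentre _ O ha, c, le_locAtCentre _ O hc, hz⟩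
  · letI : Algebra k A₀.toSubring := (inferInstance : Algebra k A₀)
    haveI : Algebra.FiniteType k A₀.toSubring := A₀.fg_iff_finiteType.mp hfg
    exact finite_integralClosure_quotient_of_ringEquiv e
      (finite_integralClosure_quotient_localization_atPrime (k := k) _)

end base

end Summit.ResolutionOfSingularities.ResolutionOfSingularities.Theorems.PfaffLine
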